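import Mathlib.Topology.ContinuousMap.SecondCountableSpace
import Mathlib.Topology.UniformSpace.CompactConvergence
import Summits.CriticalPhenomena.CardyFormulaZ2.Theorems.CardyAnchoredRigiditySubseqCardyStubCountableApproxBondNearCrude

/-!
# Stub `stub_countableApprox` (S1b) of line `registered` of crux `SubseqCardy` (stmt-CriticalPhenomena-5768)

Route `CardyAnchoredRigidity`, sub-problem `CardyFormulaZ2`: **countable uniform approximability of the bond-`ℤ²`
crossing functions** — there is a countable family `Rk : ℕ → ConformalRectangle` such that for every conformal
rectangle `R` and every `ε > 0` some member `Rk k` has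
`|bondDomainCrossingProb R δ - bondDomainCrossingProb (Rk k) δ| ≤ ε` for all small meshes `δ > 0` (equivalently: the
pseudo-metric `limsup_{δ → 0⁺} |p_R(δ) - p_{R'}(δ)|` on conformal rectangles is separable).

Proof (all percolation inputs are landed theorems of the tree; this file is bookkeeping + function-space
topology, part 1 `…StubCountableApproxBondNearCrude.lean` is plane topology):

* part 1, `stub_bondNearCrude` — G02's crossing probability is asymptotically the CRUDE one:
  `|bondDomainCrossingProb R δ - bondStdCrossingProb R (δ/√2)| ≤ ε` eventually (squeezed-image sandwich through
  Bollobás–Riordan's Claim 19 port + Schramm–Smirnov's mesh-uniform domain perturbation for crude crossings,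
  `stub_DomainPerturbation`, from their Lemma 5.1 / eq. (5.1), `SchrammSmirnov2011_lemma_5_1_holds`);
* §1 `exists_dense_homeomorphs` — plane homeomorphisms form a separable space for uniform convergence on compacta
  (a subspace of the second-countable compact-open space `C(ℂ, ℂ)`): a sequence `Ψ k` of homeomorphisms
  approximating every homeomorphism uniformly on every compact set;
* §2 the stub: `Rk k := unitSquareQuad.map (Ψ k)`. Given `R` (square model `Φ`) and `ε`, pick `Ψ k` `η`-close to
  `Φ` on `Φ⁻¹(cthickening 1 (closure Ω))`; then `T = Ψ k ∘ Φ⁻¹` is `η`-close to the identity there, `R.map T` has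
  the carrier and the arcs of `Rk k` (hence the same crude crossing probabilities), so `stub_DomainPerturbation`
  (crude probabilities of `R.map T` and `R` are `ε/3`-close eventually) and part 1 for `R` and for `Rk k` give
  `|bond R - bond (Rk k)| ≤ ε` eventually.

References: O. Schramm, S. Smirnov, Ann. Probab. 39 (2011) §5 (Lemma 5.1, eq. (5.1)); B. Bollobás, O. Riordan,
*Percolation* (2006), Ch. 7 Lemma 14, Claim 19; C. Garban, G. Pete, O. Schramm, JEMS 20 (2018) §2.1.
-/

noncomputable section

namespace Summit.CriticalPhenomena.CardyFormulaZ2.Cruxes.SubseqCardy.Birth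

open Set Filter Topology Metric MeasureTheory
open Literature.Probability.RandomPlanarGeometry (ConformalRectangle MarkedDomain)
open Literature.Probability.Percolation (IsSquareModel exists_isSquareModel unitSquareQuad bondDomainCrossingProb)
open Summit.CriticalPhenomena.CardyFormulaZ2.Theorems (tendsto_div_sqrt_two)
open Summit.CriticalPhenomena.CardyFormulaZ2.Theorems.CornerLineDescent.SymmetricSeed (bondStdCrossingProb
  stub_DomainPerturbation)

namespace CountableApprox

/-! ## §1 Plane homeomorphisms are separable for uniform convergence on compacta -/

/-- **A sequence of plane homeomorphisms approximating every plane homeomorphism uniformly on every compact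
set.** The homeomorphisms, viewed in `C(ℂ, ℂ)` with the (second countable) compact-open topology, form a
separable subspace; the compact-open topology is the topology of uniform convergence on compacta. [folklore] -/
theorem exists_dense_homeomorphs :
    ∃ Ψ : ℕ → (ℂ ≃ₜ ℂ), ∀ (Φ : ℂ ≃ₜ ℂ) (K : Set ℂ), IsCompact K → ∀ η : ℝ, 0 < η →
      ∃ k : ℕ, ∀ w ∈ K, dist (Ψ k w) (Φ w) ≤ η := by
  classical
  set S : Set C(ℂ, ℂ) := Set.range fun Φ : ℂ ≃ₜ ℂ => (Φ : C(ℂ, ℂ)) with hS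
  obtain ⟨s, hsc, hsd⟩ := TopologicalSpace.exists_countable_dense (↥S)
  have hSne : Nonempty (↥S) := ⟨⟨(Homeomorph.refl ℂ : C(ℂ, ℂ)), Homeomorph.refl ℂ, rfl⟩⟩
  obtain ⟨f, hf⟩ := hsc.exists_eq_range (hsd.nonempty)
  have hmem : ∀ n : ℕ, ((f n : ↥S) : C(ℂ, ℂ)) ∈ S := fun n => (f n).2
  choose Ψ hΨ using hmem
  refine ⟨Ψ, fun Φ K hK η hη => ?_⟩
  set x₀ : ↥S := ⟨(Φ : C(ℂ, ℂ)), Φ, rfl⟩ with hx₀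
  -- uniform `η`-closeness on `K` is a neighbourhood of `Φ` in the compact-open topology
  have hU : {g : C(ℂ, ℂ) | ∀ a ∈ K, dist ((Φ : C(ℂ, ℂ)) a) (g a) < η} ∈ 𝓝 (Φ : C(ℂ, ℂ)) := by
    have h := (ContinuousMap.tendsto_iff_forall_isCompact_tendstoUniformlyOn.1
      (tendsto_id (x := 𝓝 (Φ : C(ℂ, ℂ))))) K hK
    exact (Metric.tendstoUniformlyOn_iff.1 h) η hη
  have hU' : Subtype.val ⁻¹' {g : C(ℂ, ℂ) | ∀ a ∈ K, dist ((Φ : C(ℂ, ℂ)) a) (g a) < η} ∈ 𝓝 x₀ :=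
    continuous_subtype_val.continuousAt.preimage_mem_nhds hU
  obtain ⟨y, hys, hyU⟩ := hsd.inter_nhds_nonempty hU'
  rw [hf] at hys
  obtain ⟨k, rfl⟩ := hys
  refine ⟨k, fun w hw => ?_⟩
  have h1 : dist ((Φ : C(ℂ, ℂ)) w) (((f k : ↥S) : C(ℂ, ℂ)) w) < η := hyU w hw
  rw [← hΨ k] at h1
  rw [dist_comm]
  exact h1.le

/-! ## §2 The stub -/

/-- **Countable uniform approximability of the bond-`ℤ²` crossing functions** (the statement of the stub, proved):
with `Ψ k` the dense sequence of plane homeomorphisms of `exists_dense_homeomorphs`, the family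
`Rk k := unitSquareQuad.map (Ψ k)` works. Given `R` with square model `Φ` and `ε`, choose `Ψ k` `η`-close to `Φ`
on `Φ⁻¹(cthickening 1 (closure Ω))` (`η` from `stub_DomainPerturbation R (ε/3)`): then `T = Ψ k ∘ Φ⁻¹` moves that
neighbourhood by at most `η`, `R.map T` has the carrier and the arcs of `Rk k` (so the same crude crossing
probabilities), and `stub_bondNearCrude` for `R` and for `Rk k` finish the `ε/3` argument.
[cite: SchrammSmirnov2011, §5 Lemma 5.1] -/
theorem countableApprox :
    ∃ Rk : ℕ → ConformalRectangle, ∀ (R : ConformalRectangle) (ε : ℝ), 0 < ε →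
      ∃ k : ℕ, ∀ᶠ δ in 𝓝[>] (0 : ℝ), |bondDomainCrossingProb R δ - bondDomainCrossingProb (Rk k) δ| ≤ ε := by
  obtain ⟨Ψ, hΨ⟩ := exists_dense_homeomorphs
  refine ⟨fun k => unitSquareQuad.map (Ψ k), fun R ε hε => ?_⟩
  have hε3 : 0 < ε / 3 := by positivity
  obtain ⟨η, hη, hpert⟩ := stub_DomainPerturbation R (ε / 3) hε3
  obtain ⟨Φ, hΦ⟩ := exists_isSquareModel R
  have hKc : IsCompact (cthickening 1 (closure R.carrier)) := R.isBounded.isCompact_closure.cthickening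
  obtain ⟨k, hk⟩ := hΨ Φ (Φ.symm '' cthickening 1 (closure R.carrier)) (hKc.image Φ.symm.continuous) η hη
  refine ⟨k, ?_⟩
  set T : ℂ ≃ₜ ℂ := Φ.symm.trans (Ψ k) with hTdef
  have hTcoe : ⇑T = Ψ k ∘ Φ.symm := rfl
  have hT : ∀ z ∈ cthickening 1 (closure R.carrier), dist (T z) z ≤ η := fun z hz => by
    have h := hk (Φ.symm z) (mem_image_of_mem _ hz)
    rwa [Φ.apply_symm_apply] at h
  have hcar : (R.map T).carrier = (unitSquareQuad.map (Ψ k)).carrier := by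
    rw [MarkedDomain.carrier_map, MarkedDomain.carrier_map, hTcoe, image_comp, symm_image_carrier hΦ]
  have harc : ∀ i, (R.map T).arc i = (unitSquareQuad.map (Ψ k)).arc i := fun i => by
    rw [MarkedDomain.arc_map, MarkedDomain.arc_map, hTcoe, image_comp, symm_image_arc hΦ]
  have hcong : ∀ δ, bondStdCrossingProb (R.map T) δ = bondStdCrossingProb (unitSquareQuad.map (Ψ k)) δ :=
    fun δ => by simp only [bondStdCrossingProb, hcar, harc]
  have hev : ∀ᶠ δ in 𝓝[>] (0 : ℝ), |bondStdCrossingProb (R.map T) (δ / Real.sqrt 2) -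
      bondStdCrossingProb R (δ / Real.sqrt 2)| ≤ ε / 3 :=
    tendsto_div_sqrt_two.eventually (hpert T hT)
  filter_upwards [stub_bondNearCrude R _ hε3, stub_bondNearCrude (unitSquareQuad.map (Ψ k)) _ hε3, hev]
    with δ h1 h2 h3
  rw [hcong] at h3
  simp only [bondStdCrossingProb] at h3
  rw [abs_le] at h1 h2 h3 ⊢
  constructor <;> linarith [h1.1, h1.2, h2.1, h2.2, h3.1, h3.2]

end CountableApprox

/-- **S1b `stub_countableApprox` — countable uniform approximability of the ℤ² crossing functions** (registered
stub of line `registered` of crux `SubseqCardy`, stmt-CriticalPhenomena-5768): there is a countable family `Rk` of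
conformal rectangles such that for every conformal rectangle `R` and every `ε > 0` some member `Rk k` has
`|p_R(δ) - p_{Rk k}(δ)| ≤ ε` for all small `δ > 0`. Proof: `CountableApprox.countableApprox` (G02 ≈ crude
asymptotically, `stub_bondNearCrude`; crude crossing probabilities are asymptotically equicontinuous along plane
homeomorphisms close to the identity, `stub_DomainPerturbation`; plane homeomorphisms are separable for uniform
convergence on compacta, `exists_dense_homeomorphs`).
[cite: SchrammSmirnov2011, §5 Lemma 5.1 and eq. (5.1)] -/
theorem stub_countableApprox :
    ∃ Rk : ℕ → Literature.Probability.RandomPlanarGeometry.ConformalRectangle,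
      ∀ (R : Literature.Probability.RandomPlanarGeometry.ConformalRectangle) (ε : ℝ), 0 < ε →
        ∃ k : ℕ, ∀ᶠ δ in nhdsWithin (0 : ℝ) (Set.Ioi 0),
          |Literature.Probability.Percolation.bondDomainCrossingProb R δ -
            Literature.Probability.Percolation.bondDomainCrossingProb (Rk k) δ| ≤ ε :=
  CountableApprox.countableApprox

end Summit.CriticalPhenomena.CardyFormulaZ2.Cruxes.SubseqCardy.Birth

end
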